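import Summits.QuantumFields.YangMills.Theorems.LangevinControlUVFemtoCurvatureTwoPointCDoublingPlaquette
import HarnessLib

/-!
# Crux `FemtoCurvatureTwoPointC` (stmt-QuantumFields-16204), line `Sketch`:
# local injectivity of the slice parametrisation (`stub_sliceLoc`)

Near a configuration `τ` of the lattice gauge field every configuration is written as
`E η · cfg τ A` — the gauge transformation generated by a `𝔤`-valued site function `η` orthogonal to
the zero modes `W₀ = zeroModes τ`, applied to the exponential chart point `cfg τ A (x,i) = E(A(x,i)) τ(x,i)`
over a 1-form `A` in the gauge slice `𝒴 = slice τ = (range d⁰)ᗮ` (vocabulary of `…CDoublingDefs`).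
We prove the quantitative injectivity of this parametrisation near `(η, A) = (0, 0)`, read through the
faithful unitary representation `ρ` in matrices (sup-of-Frobenius norm on `M_N(ℂ)^E`): there are
`δ, K > 0` such that for `η, η' ∈ W₀ᗮ`, `A, A' ∈ 𝒴` of norm `< δ` and `0 < s ≤ 1`,
`s ‖F(η, A) − F(η', A')‖ ≤ K ‖F(η, sA) − F(η', sA')‖`, `F(η, A) = (ρ((E η · cfg τ A) e))_e`
(`stub_sliceLoc`, taken verbatim as a hypothesis by the lead's `stub_sublevelDoubling`: it makes the
scaling map `E η · cfg τ A ↦ E η · cfg τ (sA)` well defined and co-Lipschitz by `K/s`).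

Proof.  Componentwise `F(η, A) e = e^{M η(x)} e^{M A(e)} ρ(τ e) e^{−M η(x+e_i)}` (`e = (x, i)`,
`M = lieIso ρ`), so `F` has at `0` a STRICT derivative `L` (chain and product rules from Mathlib's
`hasStrictFDerivAt_exp_zero`) with `L(η̇, Ȧ) e = M((d⁰η̇) e + Ȧ e) ρ(τ e)`.  On `W₀ᗮ × 𝒴` the map
`L` is injective (`d⁰η̇ + Ȧ = 0` forces `Ȧ ∈ range d⁰ ∩ (range d⁰)ᗮ = 0`, then `d⁰η̇ = 0`, i.e.
`η̇ ∈ W₀ ∩ W₀ᗮ = 0`), hence bounded below by some `m > 0` (finite dimension,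
`LinearMap.exists_antilipschitzWith`).  Strictness gives `‖F p − F q − L(p − q)‖ ≤ (m/2)‖p − q‖` near
`0`, whence `‖F(η, sA) − F(η', sA')‖ ≥ (m/2) ‖(η − η', s(A − A'))‖ ≥ (m/2) s ‖(η − η', A − A')‖` and
`‖F(η, A) − F(η', A')‖ ≤ (‖L‖ + m/2) ‖(η − η', A − A')‖`; `K = 2‖L‖/m + 1`.  Flatness of `τ` is not
used.  Mathlib + the tree's exponential chart files; no named facts.
-/

set_option autoImplicit false

noncomputable section

open scoped Matrix Matrix.Norms.Frobenius InnerProductSpace Topology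
open NormedSpace Filter
open Literature.MathematicalPhysics.QuantumLattice Literature.MathematicalPhysics.QuantumFieldTheory
open Summit.QuantumFields.YangMills.Theorems.FreeEnergyLogCoefficient
open Summit.QuantumFields.YangMills.Theorems.FemtoCurvatureTwoPointC.Doubling

namespace Summit.QuantumFields.YangMills.Theorems.FemtoCurvatureTwoPointC

namespace SliceLoc

/-! ## The abstract co-Lipschitz lemma -/

/-- **Scaling is co-Lipschitz near a point of strict differentiability with injective derivative.**
Let `F : E₁ × E₂ → W` have a strict derivative `L` at `0` with `m ‖(a, b)‖ ≤ ‖L(a, b)‖` for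
`a ∈ P₁`, `b ∈ P₂`.  Then for `η − η' ∈ P₁`, `A − A' ∈ P₂`, all four of norm `< δ`, and `0 < s ≤ 1`:
`s ‖F(η, A) − F(η', A')‖ ≤ K ‖F(η, sA) − F(η', sA')‖` with `K = 2‖L‖/m + 1`. -/
theorem coLipschitz_of_hasStrictFDerivAt {E₁ E₂ W : Type*} [NormedAddCommGroup E₁] [NormedSpace ℝ E₁]
    [NormedAddCommGroup E₂] [NormedSpace ℝ E₂] [NormedAddCommGroup W] [NormedSpace ℝ W]
    {F : E₁ × E₂ → W} {Lm : E₁ × E₂ →L[ℝ] W} (hF : HasStrictFDerivAt F Lm 0)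
    (P₁ : Submodule ℝ E₁) (P₂ : Submodule ℝ E₂) {m : ℝ} (hm : 0 < m)
    (hle : ∀ a ∈ P₁, ∀ b ∈ P₂, m * ‖(a, b)‖ ≤ ‖Lm (a, b)‖) :
    ∃ δ K : ℝ, 0 < δ ∧ 0 < K ∧ ∀ (η η' : E₁) (A A' : E₂), η - η' ∈ P₁ → A - A' ∈ P₂ →
      ‖η‖ < δ → ‖η'‖ < δ → ‖A‖ < δ → ‖A'‖ < δ → ∀ s : ℝ, 0 < s → s ≤ 1 →
        s * ‖F (η, A) - F (η', A')‖ ≤ K * ‖F (η, s • A) - F (η', s • A')‖ := by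
  -- strictness: `‖F p - F q - L (p - q)‖ ≤ (m/2) ‖p - q‖` for `‖p‖, ‖q‖ < ε`
  obtain ⟨ε, hε, hεb⟩ := Metric.eventually_nhds_iff.1 (hF.isLittleO.def (half_pos hm))
  have hrem : ∀ p q : E₁ × E₂, ‖p‖ < ε → ‖q‖ < ε → ‖F p - F q - Lm (p - q)‖ ≤ m / 2 * ‖p - q‖ := by
    intro p q hp hq
    have hd : dist (p, q) ((0 : E₁ × E₂), (0 : E₁ × E₂)) < ε := by
      rw [show ((0 : E₁ × E₂), (0 : E₁ × E₂)) = (0 : (E₁ × E₂) × (E₁ × E₂)) from rfl, dist_zero_right,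
        Prod.norm_mk]
      exact max_lt hp hq
    exact hεb hd
  refine ⟨ε, 2 * ‖Lm‖ / m + 1, hε, by positivity, fun η η' A A' hη hA hηn hη'n hAn hA'n s hs hs1 => ?_⟩
  -- the four points have norm `< ε`
  have hsA : ∀ B : E₂, ‖B‖ < ε → ‖s • B‖ < ε := fun B hB => by
    rw [norm_smul, Real.norm_eq_abs, abs_of_pos hs]
    exact lt_of_le_of_lt (mul_le_of_le_one_left (norm_nonneg _) hs1) hB
  have hn1 : ‖((η, A) : E₁ × E₂)‖ < ε := by rw [Prod.norm_mk]; exact max_lt hηn hAn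
  have hn2 : ‖((η', A') : E₁ × E₂)‖ < ε := by rw [Prod.norm_mk]; exact max_lt hη'n hA'n
  have hn3 : ‖((η, s • A) : E₁ × E₂)‖ < ε := by rw [Prod.norm_mk]; exact max_lt hηn (hsA A hAn)
  have hn4 : ‖((η', s • A') : E₁ × E₂)‖ < ε := by rw [Prod.norm_mk]; exact max_lt hη'n (hsA A' hA'n)
  have hd1 : ((η, A) : E₁ × E₂) - (η', A') = (η - η', A - A') := rfl
  have hd2 : ((η, s • A) : E₁ × E₂) - (η', s • A') = (η - η', s • (A - A')) := by
    rw [Prod.mk_sub_mk, smul_sub]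
  -- lower bound on the subspace
  have hlow : m * ‖((η - η', s • (A - A')) : E₁ × E₂)‖ ≤ ‖Lm (η - η', s • (A - A'))‖ :=
    hle _ hη _ (P₂.smul_mem s hA)
  -- (i) the unscaled difference from above
  have h1 : ‖F (η, A) - F (η', A')‖ ≤ (‖Lm‖ + m / 2) * ‖((η - η', A - A') : E₁ × E₂)‖ := by
    have hr := hrem (η, A) (η', A') hn1 hn2
    rw [hd1] at hr
    calc ‖F (η, A) - F (η', A')‖
          = ‖(F (η, A) - F (η', A') - Lm (η - η', A - A')) + Lm (η - η', A - A')‖ := by rw [sub_add_cancel]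
      _ ≤ ‖F (η, A) - F (η', A') - Lm (η - η', A - A')‖ + ‖Lm (η - η', A - A')‖ := norm_add_le _ _
      _ ≤ m / 2 * ‖((η - η', A - A') : E₁ × E₂)‖ + ‖Lm‖ * ‖((η - η', A - A') : E₁ × E₂)‖ :=
          add_le_add hr (Lm.le_opNorm _)
      _ = (‖Lm‖ + m / 2) * ‖((η - η', A - A') : E₁ × E₂)‖ := by ring
  -- (ii) the scaled difference from below
  have h2 : m / 2 * ‖((η - η', s • (A - A')) : E₁ × E₂)‖ ≤ ‖F (η, s • A) - F (η', s • A')‖ := by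
    have hr := hrem (η, s • A) (η', s • A') hn3 hn4
    rw [hd2] at hr
    have hL : ‖Lm (η - η', s • (A - A'))‖ ≤ ‖F (η, s • A) - F (η', s • A')‖ +
        ‖F (η, s • A) - F (η', s • A') - Lm (η - η', s • (A - A'))‖ := by
      calc ‖Lm (η - η', s • (A - A'))‖ = ‖(F (η, s • A) - F (η', s • A')) -
            (F (η, s • A) - F (η', s • A') - Lm (η - η', s • (A - A')))‖ := by rw [sub_sub_cancel]
        _ ≤ _ := norm_sub_le _ _
    linarith
  -- (iii) scaling the second coordinate by `s ≤ 1` shrinks the sup norm by at most `s`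
  have h3 : s * ‖((η - η', A - A') : E₁ × E₂)‖ ≤ ‖((η - η', s • (A - A')) : E₁ × E₂)‖ := by
    rw [Prod.norm_mk, Prod.norm_mk, norm_smul, Real.norm_eq_abs, abs_of_pos hs]
    rcases le_total ‖η - η'‖ ‖A - A'‖ with hab | hab
    · rw [max_eq_right hab]; exact le_max_right _ _
    · rw [max_eq_left hab]
      exact le_trans (mul_le_of_le_one_left (norm_nonneg _) hs1) (le_max_left _ _)
  -- combine
  have hm2 : 2 / m * (m / 2) = 1 := by
    rw [div_mul_div_comm, mul_comm 2 m, div_self (ne_of_gt (by positivity))]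
  have h4 : ‖((η - η', s • (A - A')) : E₁ × E₂)‖ ≤ 2 / m * ‖F (η, s • A) - F (η', s • A')‖ := by
    have : ‖((η - η', s • (A - A')) : E₁ × E₂)‖ = 2 / m * (m / 2 * ‖((η - η', s • (A - A')) : E₁ × E₂)‖) := by
      rw [← mul_assoc, hm2, one_mul]
    rw [this]
    exact mul_le_mul_of_nonneg_left h2 (by positivity)
  calc s * ‖F (η, A) - F (η', A')‖
        ≤ s * ((‖Lm‖ + m / 2) * ‖((η - η', A - A') : E₁ × E₂)‖) := mul_le_mul_of_nonneg_left h1 hs.le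
    _ = (‖Lm‖ + m / 2) * (s * ‖((η - η', A - A') : E₁ × E₂)‖) := by ring
    _ ≤ (‖Lm‖ + m / 2) * ‖((η - η', s • (A - A')) : E₁ × E₂)‖ := mul_le_mul_of_nonneg_left h3 (by positivity)
    _ ≤ (‖Lm‖ + m / 2) * (2 / m * ‖F (η, s • A) - F (η', s • A')‖) := mul_le_mul_of_nonneg_left h4 (by positivity)
    _ = (‖Lm‖ * (2 / m) + 2 / m * (m / 2)) * ‖F (η, s • A) - F (η', s • A')‖ := by ring
    _ = (2 * ‖Lm‖ / m + 1) * ‖F (η, s • A) - F (η', s • A')‖ := by rw [hm2]; ring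

/-! ## The parametrisation in matrices and its strict derivative at `0` -/

variable {G : Type} [Group G] [TopologicalSpace G] [CompactSpace G] (r : LatticeRep G) {L : ℕ}

/-- The parametrisation in matrices, componentwise:
`ρ((E η · cfg τ A)(x,i)) = e^{M η(x)} e^{M A(x,i)} ρ(τ(x,i)) e^{-M η(x+e_i)}`. -/
theorem rho_gaugeTransform_gaugeExp_cfg (τ : GaugeConfig 4 L G) (η : SiteFun r L) (A : OneForm r L)
    (e : Edge 4 L) :
    r.ρ (gaugeTransform (gaugeExp r η) (cfg r τ A) e) =
      exp (lieIso r.ρ (η e.1)) * exp (lieIso r.ρ (A e)) * r.ρ (τ e) *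
        exp (-lieIso r.ρ (η (e.1.shift e.2))) := by
  rw [rho_gaugeTransform_cfg]
  simp only [gaugeExp]
  rw [rho_expChart r.ρ r.continuous, rho_expChart_inv]

/-- The derivative formula: `M(η̇ x) T − T M(η̇(x+e_i)) + M(Ȧ e) T = M((d⁰η̇) e + Ȧ e) T`, `T = ρ(τ e)`
(`T M(b) T⁻¹ = M(Ad_{τ e} b)`). -/
theorem lieIso_dZero_add_mul (τ : GaugeConfig 4 L G) (v : SiteFun r L × OneForm r L) (e : Edge 4 L) :
    lieIso r.ρ (dZero r τ v.1 e + v.2 e) * r.ρ (τ e) =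
      lieIso r.ρ (v.1 e.1) * r.ρ (τ e) - r.ρ (τ e) * lieIso r.ρ (v.1 (e.1.shift e.2)) +
        lieIso r.ρ (v.2 e) * r.ρ (τ e) := by
  rw [show dZero r τ v.1 e = v.1 e.1 - adFib r (τ e) (v.1 (e.1.shift e.2)) from rfl, map_add, map_sub,
    lieIso_adFib, Matrix.add_mul, Matrix.sub_mul, Matrix.mul_assoc _ (r.ρ (τ e)⁻¹) (r.ρ (τ e)), rho_inv_mul,
    Matrix.mul_one]

variable [NeZero L]

/-- **Strict derivative of one component of the parametrisation at `0`**: the map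
`(η, A) ↦ ρ((E η · cfg τ A) e)` has at `(0, 0)` a strict derivative `φ'` with
`φ' (η̇, Ȧ) = M((d⁰η̇) e + Ȧ e) · ρ(τ e)`. -/
theorem exists_hasStrictFDerivAt_comp (τ : GaugeConfig 4 L G) (e : Edge 4 L) :
    ∃ φ' : (SiteFun r L × OneForm r L) →L[ℝ] Matrix (Fin r.N) (Fin r.N) ℂ,
      HasStrictFDerivAt (fun p : SiteFun r L × OneForm r L =>
        r.ρ (gaugeTransform (gaugeExp r p.1) (cfg r τ p.2) e)) φ' 0 ∧
      ∀ v : SiteFun r L × OneForm r L,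
        φ' v = lieIso r.ρ (dZero r τ v.1 e + v.2 e) * r.ρ (τ e) := by
  -- the three linear maps `p ↦ M (p.1 e.1)`, `p ↦ M (p.2 e)`, `p ↦ -M (p.1 (e.1 + e_i))`
  set Mc : Fib r →L[ℝ] Matrix (Fin r.N) (Fin r.N) ℂ := (lieIso r.ρ).toContinuousLinearMap
  set ℓ₁ : (SiteFun r L × OneForm r L) →L[ℝ] Matrix (Fin r.N) (Fin r.N) ℂ :=
    (Mc.comp (PiLp.proj 2 (fun _ : Site 4 L => Fib r) e.1)).comp
      (ContinuousLinearMap.fst ℝ (SiteFun r L) (OneForm r L))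
  set ℓ₂ : (SiteFun r L × OneForm r L) →L[ℝ] Matrix (Fin r.N) (Fin r.N) ℂ :=
    (Mc.comp (PiLp.proj 2 (fun _ : Edge 4 L => Fib r) e)).comp
      (ContinuousLinearMap.snd ℝ (SiteFun r L) (OneForm r L))
  set ℓ₃ : (SiteFun r L × OneForm r L) →L[ℝ] Matrix (Fin r.N) (Fin r.N) ℂ :=
    -((Mc.comp (PiLp.proj 2 (fun _ : Site 4 L => Fib r) (e.1.shift e.2))).comp
      (ContinuousLinearMap.fst ℝ (SiteFun r L) (OneForm r L)))
  have hℓ₁v : ∀ p : SiteFun r L × OneForm r L, ℓ₁ p = lieIso r.ρ (p.1 e.1) := fun p => rfl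
  have hℓ₂v : ∀ p : SiteFun r L × OneForm r L, ℓ₂ p = lieIso r.ρ (p.2 e) := fun p => rfl
  have hℓ₃v : ∀ p : SiteFun r L × OneForm r L, ℓ₃ p = -lieIso r.ρ (p.1 (e.1.shift e.2)) := fun p => rfl
  have hE : HasStrictFDerivAt (exp : Matrix (Fin r.N) (Fin r.N) ℂ → Matrix (Fin r.N) (Fin r.N) ℂ)
      (1 : Matrix (Fin r.N) (Fin r.N) ℂ →L[ℝ] Matrix (Fin r.N) (Fin r.N) ℂ) 0 :=
    hasStrictFDerivAt_exp_zero
  have hD : ∀ ℓ : (SiteFun r L × OneForm r L) →L[ℝ] Matrix (Fin r.N) (Fin r.N) ℂ,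
      HasStrictFDerivAt (fun p => exp (ℓ p)) ℓ 0 := by
    intro ℓ
    have h := hE
    rw [← map_zero ℓ] at h
    exact (h.comp 0 ℓ.hasStrictFDerivAt).congr_fderiv (ContinuousLinearMap.ext fun _ => rfl)
  have h := (((hD ℓ₁).fun_mul' (hD ℓ₂)).mul_const' (r.ρ (τ e))).fun_mul' (hD ℓ₃)
  -- the same derivative, re-elaborated in the present instance context (needed for `simp` below)
  have h' : HasStrictFDerivAt
      (fun p : SiteFun r L × OneForm r L => exp (ℓ₁ p) * exp (ℓ₂ p) * r.ρ (τ e) * exp (ℓ₃ p))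
      ((exp (ℓ₁ 0) * exp (ℓ₂ 0) * r.ρ (τ e)) • ℓ₃ +
        MulOpposite.op (exp (ℓ₃ 0)) • MulOpposite.op (r.ρ (τ e)) •
          (exp (ℓ₁ 0) • ℓ₂ + MulOpposite.op (exp (ℓ₂ 0)) • ℓ₁)) 0 := h
  have hfun : (fun p : SiteFun r L × OneForm r L => r.ρ (gaugeTransform (gaugeExp r p.1) (cfg r τ p.2) e)) =
      fun p => exp (ℓ₁ p) * exp (ℓ₂ p) * r.ρ (τ e) * exp (ℓ₃ p) := by
    funext p
    rw [rho_gaugeTransform_gaugeExp_cfg, hℓ₁v, hℓ₂v, hℓ₃v]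
  refine ⟨_, by rw [hfun]; exact h', fun v => ?_⟩
  rw [lieIso_dZero_add_mul]
  simp only [_root_.add_apply, _root_.smul_apply, smul_eq_mul, op_smul_eq_mul, map_zero, exp_zero,
    Matrix.one_mul, Matrix.mul_one]
  rw [hℓ₁v, hℓ₂v, hℓ₃v, Matrix.mul_neg, Matrix.add_mul]
  abel

/-- **Strict derivative of the parametrisation at `0`**, assembled over the edges: a continuous linear
`L` with `L(η̇, Ȧ) e = M((d⁰η̇) e + Ȧ e) · ρ(τ e)`. -/
theorem exists_hasStrictFDerivAt (τ : GaugeConfig 4 L G) :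
    ∃ Lm : (SiteFun r L × OneForm r L) →L[ℝ] (Edge 4 L → Matrix (Fin r.N) (Fin r.N) ℂ),
      HasStrictFDerivAt (fun p : SiteFun r L × OneForm r L => fun e : Edge 4 L =>
        r.ρ (gaugeTransform (gaugeExp r p.1) (cfg r τ p.2) e)) Lm 0 ∧
      ∀ (v : SiteFun r L × OneForm r L) (e : Edge 4 L),
        Lm v e = lieIso r.ρ (dZero r τ v.1 e + v.2 e) * r.ρ (τ e) := by
  choose φ' hφ' hφ'v using fun e : Edge 4 L => exists_hasStrictFDerivAt_comp r τ e
  exact ⟨ContinuousLinearMap.pi φ', hasStrictFDerivAt_pi.2 hφ', fun v e => hφ'v e v⟩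

/-! ## Injectivity of the derivative on `W₀ᗮ × 𝒴` -/

/-- **Algebraic injectivity**: if `η ⊥ W₀`, `A ∈ 𝒴 = (range d⁰)ᗮ` and `d⁰η + A = 0`, then `η = 0` and
`A = 0` (`A ∈ range d⁰ ∩ (range d⁰)ᗮ`, then `d⁰η = 0` says `η ∈ W₀`). -/
theorem eq_zero_of_dZero_add_eq_zero (τ : GaugeConfig 4 L G) {η : SiteFun r L} {A : OneForm r L}
    (hη : η ∈ (zeroModes r τ)ᗮ) (hA : A ∈ slice r τ) (h : ∀ e : Edge 4 L, dZero r τ η e + A e = 0) :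
    η = 0 ∧ A = 0 := by
  have hAeq : dZero r τ (-η) = A := PiLp.ext fun e => by
    rw [map_neg, PiLp.neg_apply]
    exact (eq_neg_of_add_eq_zero_right (h e)).symm
  have hA0 : A = 0 := by
    rw [slice, Submodule.mem_orthogonal] at hA
    exact inner_self_eq_zero.1 (hA A ⟨-η, hAeq⟩)
  have hd : ∀ e : Edge 4 L, dZero r τ η e = 0 := fun e => by
    have := h e
    rwa [hA0, PiLp.zero_apply, add_zero] at this
  have hz : η ∈ zeroModes r τ := by
    rw [mem_zeroModes_iff]
    intro i
    refine PiLp.ext fun x => ?_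
    have := hd (x, i)
    rw [dZero_apply, sub_eq_zero] at this
    rw [transport_apply]
    exact this.symm
  rw [Submodule.mem_orthogonal] at hη
  exact ⟨inner_self_eq_zero.1 (hη η hz), hA0⟩

/-- **The derivative is bounded below on `W₀ᗮ × 𝒴`**: `m ‖(η, A)‖ ≤ ‖L(η, A)‖` for some `m > 0`
(injective by `eq_zero_of_dZero_add_eq_zero`, finite dimension). -/
theorem exists_lower_bound (τ : GaugeConfig 4 L G)
    (Lm : (SiteFun r L × OneForm r L) →L[ℝ] (Edge 4 L → Matrix (Fin r.N) (Fin r.N) ℂ))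
    (hLm : ∀ (v : SiteFun r L × OneForm r L) (e : Edge 4 L),
      Lm v e = lieIso r.ρ (dZero r τ v.1 e + v.2 e) * r.ρ (τ e)) :
    ∃ m : ℝ, 0 < m ∧ ∀ a ∈ (zeroModes r τ)ᗮ, ∀ b ∈ slice r τ, m * ‖(a, b)‖ ≤ ‖Lm (a, b)‖ := by
  set P : Submodule ℝ (SiteFun r L × OneForm r L) := ((zeroModes r τ)ᗮ).prod (slice r τ)
  set Ψ : P →ₗ[ℝ] (Edge 4 L → Matrix (Fin r.N) (Fin r.N) ℂ) :=
    (Lm : (SiteFun r L × OneForm r L) →ₗ[ℝ] (Edge 4 L → Matrix (Fin r.N) (Fin r.N) ℂ)).comp P.subtype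
  have hΨv : ∀ v : P, Ψ v = Lm (v : SiteFun r L × OneForm r L) := fun v => rfl
  have hker : LinearMap.ker Ψ = ⊥ := by
    rw [LinearMap.ker_eq_bot']
    intro v hv
    obtain ⟨hv1, hv2⟩ := Submodule.mem_prod.1 v.2
    have h0 : ∀ e : Edge 4 L, dZero r τ (v : SiteFun r L × OneForm r L).1 e +
        (v : SiteFun r L × OneForm r L).2 e = 0 := fun e => by
      have he : Lm (v : SiteFun r L × OneForm r L) e = 0 := by rw [← hΨv, hv]; rfl
      rw [hLm] at he
      have he' : lieIso r.ρ (dZero r τ (v : SiteFun r L × OneForm r L).1 e +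
          (v : SiteFun r L × OneForm r L).2 e) = 0 := by
        have := congrArg (· * r.ρ (τ e)⁻¹) he
        simpa only [Matrix.mul_assoc, rho_mul_inv, Matrix.mul_one, Matrix.zero_mul] using this
      rw [← norm_eq_zero, ← norm_lieIso r.ρ, he', norm_zero]
    obtain ⟨h1, h2⟩ := eq_zero_of_dZero_add_eq_zero r τ hv1 hv2 h0
    exact Subtype.ext (Prod.ext h1 h2)
  obtain ⟨K, hK0, hK⟩ := Ψ.exists_antilipschitzWith hker
  have hKpos : (0 : ℝ) < K := by exact_mod_cast hK0
  refine ⟨(K : ℝ)⁻¹, by positivity, fun a ha b hb => ?_⟩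
  have hle : ‖((a, b) : SiteFun r L × OneForm r L)‖ ≤ K * ‖Ψ ⟨(a, b), Submodule.mem_prod.2 ⟨ha, hb⟩⟩‖ := by
    have := hK.le_mul_dist ⟨(a, b), Submodule.mem_prod.2 ⟨ha, hb⟩⟩ 0
    rw [dist_zero_right, map_zero, dist_zero_right] at this
    exact this
  rw [inv_mul_le_iff₀ hKpos]
  exact hle

end SliceLoc

/-- **Local injectivity of the slice parametrisation with a constant (`stub_sliceLoc`).**  For every
configuration `τ` there are `δ, K > 0` such that for `η, η' ⊥ zeroModes τ`, `A, A' ∈ slice τ`, all of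
norm `< δ`, and `0 < s ≤ 1`, the matrix tuples `F(η, A) = (ρ((E η · cfg τ A) e))_e` satisfy
`s ‖F(η, A) − F(η', A')‖ ≤ K ‖F(η, sA) − F(η', sA')‖` (sup-of-Frobenius norm): the scaling
`A ↦ sA` of the slice coordinate is well defined on gauge orbits and co-Lipschitz by `K/s`. -/
theorem stub_sliceLoc : ∀ {G : Type} [Group G] [TopologicalSpace G] [CompactSpace G] (r : LatticeRep G) {L : ℕ} [NeZero L] (τ : GaugeConfig 4 L G), ∃ δ K : ℝ, 0 < δ ∧ 0 < K ∧ ∀ (η η' : Summit.QuantumFields.YangMills.Theorems.FemtoCurvatureTwoPointC.Doubling.SiteFun r L) (A A' : Summit.QuantumFields.YangMills.Theorems.FemtoCurvatureTwoPointC.Doubling.OneForm r L), η ∈ (Summit.QuantumFields.YangMills.Theorems.FemtoCurvatureTwoPointC.Doubling.zeroModes r τ)ᗮ → η' ∈ (Summit.QuantumFields.YangMills.Theorems.FemtoCurvatureTwoPointC.Doubling.zeroModes r τ)ᗮ → A ∈ Summit.QuantumFields.YangMills.Theorems.FemtoCurvatureTwoPointC.Doubling.slice r τ → A' ∈ Summit.QuantumFields.YangMills.Theorems.FemtoCurvatureTwoPointC.Doubling.slice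 r τ → ‖η‖ < δ → ‖η'‖ < δ → ‖A‖ < δ → ‖A'‖ < δ → ∀ s : ℝ, 0 < s → s ≤ 1 → s * ‖(fun e : Edge 4 L => r.ρ (gaugeTransform (Summit.QuantumFields.YangMills.Theorems.FemtoCurvatureTwoPointC.Doubling.gaugeExp r η) (Summit.QuantumFields.YangMills.Theorems.FemtoCurvatureTwoPointC.Doubling.cfg r τ A) e) - r.ρ (gaugeTransform (Summit.QuantumFields.YangMills.Theorems.FemtoCurvatureTwoPointC.Doubling.gaugeExp r η') (Summit.QuantumFields.YangMills.Theorems.FemtoCurvatureTwoPointC.Doubling.cfg r τ A') e))‖ ≤ K * ‖(fun e : Edge 4 L => r.ρ (gaugeTransform (Summit.QuantumFields.YangMills.Theorems.FemtoCurvatureTwoPointC.Doubling.gaugeExp r η) (Summit.QuantumFields.YangMills.Theorems.FemtoCurvatureTwoPointC.Doubling.cfg r τ (s • A)) e) - r.ρ (gaugeTransform (Summit.QuantumFields.YangMills.Theorems.FemtoCurvatureTwoPointC.Doubling.gaugeExp r η') (Summit.QuantumFields.YangMills.Theorems.FemtoCurvatureTwoPointC.Doubling.cfg r τ (s • A'))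 e))‖ := by
  intro G _ _ _ r L _ τ
  obtain ⟨Lm, hF, hLm⟩ := SliceLoc.exists_hasStrictFDerivAt r τ
  obtain ⟨m, hm, hle⟩ := SliceLoc.exists_lower_bound r τ Lm hLm
  obtain ⟨δ, K, hδ, hK, h⟩ :=
    SliceLoc.coLipschitz_of_hasStrictFDerivAt hF ((zeroModes r τ)ᗮ) (slice r τ) hm hle
  refine ⟨δ, K, hδ, hK, fun η η' A A' hη hη' hA hA' hηn hη'n hAn hA'n s hs hs1 => ?_⟩
  exact h η η' A A' (Submodule.sub_mem _ hη hη') (Submodule.sub_mem _ hA hA') hηn hη'n hAn hA'n s hs hs1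

end Summit.QuantumFields.YangMills.Theorems.FemtoCurvatureTwoPointC

end
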